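import Literature.MeasureTheory.Group.HaarLocalChart
import Literature.MeasureTheory.Group.UnimodularOfCocompact

/-!
# Haar measure on a chart window, LEFT Haar measures: a locally left-invariant measure carried by a window is proportional
# to Haar measure there, for an ARBITRARY (not necessarily unimodular) locally compact group
# (the averaging lemma behind [Helgason2000] Ch. I §1 Thm. 1.14 (13), with the modular function)

Topic `MeasureTheory/Group`; namespace `Literature.MeasureTheory.Group.HaarLocalChartLeft`.  THEOREMS ONLY (no definition, no
named fact, no instance, no `sorry`).  Cell `hodgecm-mathlib`, F0∕P3, road «DM∞» (archimedean Dixmier–Malliavin, weak form, for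
`U(H)(L⁺ ⊗ ℝ)`), brick B2: the group `U(H)(L⁺ ⊗ ℝ)` is not compact and, for a degenerate `H`, not unimodular, so the two-sided
hypothesis `[IsMulRightInvariant μ]` of ★ `Literature.MeasureTheory.Group.HaarLocalChart` (p320990) has to go.

THE RESULT.  Let `G` be a second countable locally compact group with a (left) Haar measure `μ` on its Borel σ-algebra and modular
function `Δ` (Mathlib's `MeasureTheory.Measure.modularCharacter`, `(· g)_* μ = Δ(g) • μ`), `V ⊆ G` a measurable «window», and `ν` an
s-finite measure CARRIED BY `V` (`ν Vᶜ = 0`) which is **locally left-invariant on the window**: for every `g ∈ G` and every measurable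
`B ⊆ V` with `g⁻¹B ⊆ V`, `ν (g⁻¹ B) = ν B`.  Then, for every measurable `B ⊆ V`,

  `μ(V⁻¹) · ν(B) = (∫_V Δ dν) · μ(B)`                                   (`measure_inv_mul_eq_lintegral_mul_measure`),

i.e. `ν = (∫_V Δ dν / μ V⁻¹) · μ|_V` (`eq_smul_restrict_of_locallyInvariant`) — on the window, `ν` IS Haar measure up to a constant;
for a unimodular `G` (`Δ = 1`) the constant is ★ `HaarLocalChart`'s `ν V / μ V⁻¹`.

PROOF (Helgason's averaging device, as in ★ `HaarLocalChart`, with one change).  `Φ(B) := ∫_G ν(g⁻¹B) dμ(g)` is computed twice by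
Tonelli.  (b) [UNCHANGED, imported BY NAME: ★ `HaarLocalChart.lintegral_measure_preimage_mul_eq_of_locallyInvariant`, which uses LEFT
invariance only] `Φ(B) = μ(V⁻¹) · ν(B)`.  (a′) [NEW] `ν(g⁻¹B) = ∫ 1_B(gx) dν(x)`, so `Φ(B) = ∫ μ{g : gx ∈ B} dν(x) = ∫ μ(Bx⁻¹) dν(x)`,
and `μ(Bx⁻¹) = ((· x)_* μ)(B) = Δ(x) μ(B)` (★ `Literature.MeasureTheory.Group.map_mul_right_eq_modularCharacter_smul`, the second
countable form of Mathlib's `map_right_mul_eq_modularCharacterFun_smul`); hence `Φ(B) = (∫ Δ dν) · μ(B)`.  Measurability of `Δ` is read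
off the same identity at a fixed compact neighbourhood `K` of `1`: `Δ(x) = μ(Kx⁻¹)/μ(K)` (`measurable_coe_modularCharacter`).

HONEST SCOPE.  Pure measure theory on groups (Mathlib + two ★ tree lemmas).  Nothing here is specific to Lie groups; no chart is built
in this file; the constant is not evaluated.  Consumer: brick B5b of the road (Haar measure of `U(H)(L⁺ ⊗ ℝ)` in Cayley coordinates).
HC_CM is proved only modulo the printed citations until rung 0 closes; this file discharges no printed statement.

## References
* S. Helgason, *Groups and Geometric Analysis*, AMS Math. Surveys Monogr. 83 (2000), Ch. I §1, Prop. 1.13 and Theorem 1.14 (12)–(13),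
  p. 96. [Helgason2000]
* G. B. Folland, *A Course in Abstract Harmonic Analysis* (1995), §2.4 (the modular function, `(2.24)`–`(2.26)`). [Folland1995]
-/

noncomputable section

open MeasureTheory MeasureTheory.Measure Set Function Filter
open scoped ENNReal NNReal Topology Pointwise

namespace Literature.MeasureTheory.Group.HaarLocalChartLeft

variable {G : Type*} [Group G] [TopologicalSpace G] [IsTopologicalGroup G] [LocallyCompactSpace G]
  [SecondCountableTopology G] [MeasurableSpace G] [BorelSpace G]
  (μ : Measure G) [IsHaarMeasure μ]

/-! ## §1 The modular function: right translates of a left Haar measure -/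

/-- `μ(B x⁻¹) = Δ(x) · μ(B)`: the measure of the right translate `{g : g x ∈ B}` of a measurable set under a left Haar measure.
[cite: Folland1995, §2.4 (2.24)] -/
theorem measure_preimage_mul_right_eq_modularCharacter_mul {B : Set G} (hB : MeasurableSet B) (x : G) :
    μ ((fun g => g * x) ⁻¹' B) = (modularCharacter x : ℝ≥0∞) * μ B := by
  have h := Literature.MeasureTheory.Group.map_mul_right_eq_modularCharacter_smul μ x
  have h1 : μ ((fun g => g * x) ⁻¹' B) = (Measure.map (· * x) μ) B := (Measure.map_apply (measurable_mul_const x) hB).symm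
  rw [h1, h, Measure.smul_apply, ENNReal.smul_def, smul_eq_mul]

include μ in
/-- The modular function is Borel measurable (as an `ℝ≥0∞`-valued function): `Δ(x) = μ(K x⁻¹) / μ(K)` for any compact `K` of positive
measure, and `x ↦ μ(K x⁻¹)` is measurable (Mathlib `measurable_measure_mul_right`). [cite: Folland1995, §2.4 Prop. 2.24] -/
theorem measurable_coe_modularCharacter : Measurable fun x : G => (modularCharacter x : ℝ≥0∞) := by
  obtain ⟨K, hK, h1K⟩ := exists_compact_mem_nhds (1 : G)
  set U : Set G := interior K with hU
  have hUo : IsOpen U := isOpen_interior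
  have hUm : MeasurableSet U := hUo.measurableSet
  have h1U : (1 : G) ∈ U := mem_interior_iff_mem_nhds.mpr h1K
  have hUpos : μ U ≠ 0 := (hUo.measure_pos μ ⟨1, h1U⟩).ne'
  have hUtop : μ U ≠ ∞ := (lt_of_le_of_lt (measure_mono interior_subset) hK.measure_lt_top).ne
  have hmeas : Measurable fun x : G => μ ((fun g => g * x) ⁻¹' U) := measurable_measure_mul_right μ hUm
  have heq : (fun x : G => (modularCharacter x : ℝ≥0∞)) = fun x => μ ((fun g => g * x) ⁻¹' U) / μ U := by
    funext x
    rw [measure_preimage_mul_right_eq_modularCharacter_mul μ hUm x, mul_div_assoc, ENNReal.div_self hUpos hUtop, mul_one]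
  rw [heq]
  exact hmeas.div_const _

/-! ## §2 The averaging lemma for a left Haar measure -/

section Averaging

variable (ν : Measure G) [SFinite ν] {V : Set G}

variable {μ ν}

/-- Step (a′): `∫ ν(g⁻¹B) dμ(g) = (∫ Δ dν) · μ(B)` — Tonelli and `μ(Bx⁻¹) = Δ(x) μ(B)` (replaces the right-invariant step (a) of
★ `HaarLocalChart.lintegral_measure_preimage_mul_eq`). [cite: Helgason2000, Ch. I §1 Thm. 1.14 (13) p. 96] [cite: Folland1995, §2.4 (2.24)] -/
theorem lintegral_measure_preimage_mul_eq_lintegral_modularCharacter_mul {B : Set G} (hB : MeasurableSet B) :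
    ∫⁻ g, ν ((fun x => g * x) ⁻¹' B) ∂μ = (∫⁻ x, (modularCharacter x : ℝ≥0∞) ∂ν) * μ B := by
  have hmeas : Measurable fun p : G × G => B.indicator (1 : G → ℝ≥0∞) (p.1 * p.2) :=
    (measurable_one.indicator hB).comp measurable_mul
  have h1 : ∀ g : G, ν ((fun x => g * x) ⁻¹' B) = ∫⁻ x, B.indicator (1 : G → ℝ≥0∞) (g * x) ∂ν := by
    intro g
    rw [← lintegral_indicator_one ((measurable_const_mul g) hB)]
    rfl
  simp_rw [h1]
  rw [lintegral_lintegral_swap hmeas.aemeasurable]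
  have h2 : ∀ x : G, ∫⁻ g, B.indicator (1 : G → ℝ≥0∞) (g * x) ∂μ = (modularCharacter x : ℝ≥0∞) * μ B := by
    intro x
    have : ∫⁻ g, B.indicator (1 : G → ℝ≥0∞) (g * x) ∂μ = ∫⁻ g, ((fun h => h * x) ⁻¹' B).indicator 1 g ∂μ := rfl
    rw [this, lintegral_indicator_one ((measurable_mul_const x) hB), measure_preimage_mul_right_eq_modularCharacter_mul μ hB x]
  simp_rw [h2]
  rw [lintegral_mul_const _ (measurable_coe_modularCharacter μ)]

/-- **THE AVERAGING LEMMA, LEFT HAAR MEASURE.**  `μ` a Haar measure of a second countable locally compact group, `ν` s-finite,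
carried by the measurable window `V` and locally left-invariant on it: `μ(V⁻¹) · ν(B) = (∫ Δ dν) · μ(B)` for every measurable `B ⊆ V`.
[cite: Helgason2000, Ch. I §1 Thm. 1.14 (13) p. 96] [cite: Folland1995, §2.4] -/
theorem measure_inv_mul_eq_lintegral_mul_measure (hV : MeasurableSet V) (hνV : ν Vᶜ = 0)
    (hloc : ∀ (g : G) (B : Set G), MeasurableSet B → B ⊆ V → (fun x => g * x) ⁻¹' B ⊆ V →
      ν ((fun x => g * x) ⁻¹' B) = ν B)
    {B : Set G} (hB : MeasurableSet B) (hBV : B ⊆ V) :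
    μ V⁻¹ * ν B = (∫⁻ x, (modularCharacter x : ℝ≥0∞) ∂ν) * μ B := by
  rw [← HaarLocalChart.lintegral_measure_preimage_mul_eq_of_locallyInvariant (μ := μ) hV hνV hloc hB hBV,
    lintegral_measure_preimage_mul_eq_lintegral_modularCharacter_mul (μ := μ) (ν := ν) hB]

omit [SecondCountableTopology G] [BorelSpace G] [SFinite ν] in
/-- The constant is carried by the window: `∫ Δ dν = ∫_V Δ dν`. [cite: Helgason2000, Ch. I §1 Thm. 1.14 (13) p. 96] -/
theorem lintegral_modularCharacter_eq_setLIntegral (hνV : ν Vᶜ = 0) :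
    ∫⁻ x, (modularCharacter x : ℝ≥0∞) ∂ν = ∫⁻ x in V, (modularCharacter x : ℝ≥0∞) ∂ν := by
  have hae : ∀ᵐ x ∂ν, x ∈ V := by
    rw [ae_iff]
    exact hνV
  rw [restrict_eq_self_of_ae_mem hae]

/-- **On the window, `ν` is a constant multiple of Haar measure**: if moreover `0 < μ(V⁻¹) < ∞` then
`ν = (∫ Δ dν / μ V⁻¹) • μ|_V`. [cite: Helgason2000, Ch. I §1 Thm. 1.14 (13) p. 96] -/
theorem eq_smul_restrict_of_locallyInvariant (hV : MeasurableSet V) (hνV : ν Vᶜ = 0)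
    (hloc : ∀ (g : G) (B : Set G), MeasurableSet B → B ⊆ V → (fun x => g * x) ⁻¹' B ⊆ V →
      ν ((fun x => g * x) ⁻¹' B) = ν B)
    (h0 : μ V⁻¹ ≠ 0) (htop : μ V⁻¹ ≠ ∞) :
    ν = ((∫⁻ x, (modularCharacter x : ℝ≥0∞) ∂ν) / μ V⁻¹) • μ.restrict V := by
  have hae : ∀ᵐ x ∂ν, x ∈ V := by
    rw [ae_iff]
    exact hνV
  have hνres : ν = ν.restrict V := (restrict_eq_self_of_ae_mem hae).symm
  ext B hB
  rw [Measure.smul_apply, smul_eq_mul, Measure.restrict_apply hB]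
  conv_lhs => rw [hνres, Measure.restrict_apply hB]
  have h := measure_inv_mul_eq_lintegral_mul_measure (μ := μ) (ν := ν) hV hνV hloc (hB.inter hV) inter_subset_right
  rw [← ENNReal.mul_div_right_comm, ENNReal.eq_div_iff h0 htop]
  exact h

/-- `lintegral` form of the averaging lemma: `μ(V⁻¹) · ∫ F dν = (∫ Δ dν) · ∫_V F dμ` for every `F : G → [0, ∞]`.
[cite: Helgason2000, Ch. I §1 Thm. 1.14 (13) p. 96] -/
theorem measure_inv_mul_lintegral_eq (hV : MeasurableSet V) (hνV : ν Vᶜ = 0)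
    (hloc : ∀ (g : G) (B : Set G), MeasurableSet B → B ⊆ V → (fun x => g * x) ⁻¹' B ⊆ V →
      ν ((fun x => g * x) ⁻¹' B) = ν B)
    (F : G → ℝ≥0∞) :
    μ V⁻¹ * ∫⁻ x, F x ∂ν = (∫⁻ x, (modularCharacter x : ℝ≥0∞) ∂ν) * ∫⁻ x in V, F x ∂μ := by
  have hae : ∀ᵐ x ∂ν, x ∈ V := by
    rw [ae_iff]
    exact hνV
  have hνres : ν.restrict V = ν := restrict_eq_self_of_ae_mem hae
  have hmeas : (μ V⁻¹) • ν = (∫⁻ x, (modularCharacter x : ℝ≥0∞) ∂ν) • μ.restrict V := by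
    ext B hB
    have hνB : ν B = ν (B ∩ V) := by rw [← Measure.restrict_apply hB, hνres]
    rw [Measure.smul_apply, smul_eq_mul, Measure.smul_apply, smul_eq_mul, Measure.restrict_apply hB, hνB]
    exact measure_inv_mul_eq_lintegral_mul_measure (μ := μ) (ν := ν) hV hνV hloc (hB.inter hV) inter_subset_right
  have := congrArg (fun m : Measure G => ∫⁻ x, F x ∂m) hmeas
  simpa only [lintegral_smul_measure, smul_eq_mul] using this

/-- **Window with compact closure and non-empty interior** (the shape in which charts deliver it): if `V` is open, non-empty and
relatively compact, the hypotheses `0 < μ(V⁻¹) < ∞` hold automatically, so `ν = κ • μ|_V` with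
`κ = ∫ Δ dν / μ V⁻¹`. [cite: Helgason2000, Ch. I §1 Thm. 1.14 (13) p. 96] -/
theorem eq_smul_restrict_of_locallyInvariant_of_isOpen (hVo : IsOpen V) (hVne : V.Nonempty) (hVc : IsCompact (closure V))
    (hνV : ν Vᶜ = 0)
    (hloc : ∀ (g : G) (B : Set G), MeasurableSet B → B ⊆ V → (fun x => g * x) ⁻¹' B ⊆ V →
      ν ((fun x => g * x) ⁻¹' B) = ν B) :
    ν = ((∫⁻ x, (modularCharacter x : ℝ≥0∞) ∂ν) / μ V⁻¹) • μ.restrict V := by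
  refine eq_smul_restrict_of_locallyInvariant (μ := μ) (ν := ν) hVo.measurableSet hνV hloc ?_ ?_
  · exact (hVo.inv.measure_pos μ hVne.inv).ne'
  · refine (lt_of_le_of_lt (measure_mono ?_) hVc.inv.measure_lt_top).ne
    exact Set.inv_subset_inv.mpr subset_closure

end Averaging

end Literature.MeasureTheory.Group.HaarLocalChartLeft

end
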